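import Mathlib
import HarnessLib
import Summits.HubbardSuperconductivity.HubbardSuperconductivity.Theorems.KLProgrammeKLRegimeSplitGeoShellLog
import Summits.HubbardSuperconductivity.HubbardSuperconductivity.Theorems.KLProgrammeKLRegimeSplitEdgeFactsComplFamily

/-!
# Route `KLProgramme` — ENGINE child gen 8 (stmt-HubbardSuperconductivity-20437 `KLRegimeEngineV17F2`), skeleton v2 class #5 «(S)-transfer» rev 3 (RELATIVE family):
# the INDEX-KEYED relative bar — `klIdxMass`, `klIdxOverlap`, `klIdxPrefactor`, `transferBarRelIdx`, its ARITHMETIC inheritance room and its hosting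
# (cell gate-hubbard-kl, seat hubbard-kl-p1 g13 = class-#5 text owner; located defect «(F)-MASS-KEY», KL STATUS 2026-08-28T00:16:48Z)

WHY.  The symbol-keyed bar of record `transferBarRelAtF … n ψ₁ ψ₂ = transferBarRelAtWF … n (klSoftMass (Kₙ) n (ψ₁−ψ₂)) (klShellOverlap (Kₙ) n (ψ₁−ψ₂))` (p586991) measures
the pair's weights in the FLOWING frame `Kₙ`.  In the relative induction the HYPOTHESIS at scale `n` then bounds the inherited residue by `W_F(n, ms^{Kₙ}, 0)` while the
CONCLUSION at `n+1` must be produced with `W_F(n+1, 4·ms^{K_{n+1}}, ov^{K_{n+1}})` — the soft mass of the SAME profile `σ_{m′,m}` measured in two different frames; the room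
lemma `transferBarRelAtWF_succ_room` closes the step only if `ms^{Kₙ} ≤ ms^{K_{n+1}}`, which is false in general (the two differ by a relative `ε_n` of either sign), and the
surplus has no slot (the `2^{−n}`, cubic and `1/L` slots are zero-slack equalities).  For the CUTOFF-BUILT family (plan g21 (R54x)) the weights have FRAME-FREE,
INDEX-DETERMINED majorants — for the pair `(s_{n,m} | s_{n,m′})`, `n ≤ m′ ≤ m`: soft mass `≤ 15367·4^{−(m′−n)}` in EVERY admissible frame (`klSoftMass_compl_sub_compl_le_deep`,
p588011) and born overlap `= 0` unless `m′ = n`, `≤ 15367` then (`klShellOverlap_compl_sub_compl_eq_zero/_le`) — and keying the bar on them makes inheritance EXACT ARITHMETIC: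

* §1 `klIdxMass n m′ := 15367·(4^{m′−n})⁻¹`, `klIdxOverlap n m′ := 15367·[m′ = n]`, `klIdxPrefactor r n := r·(2 − 2^{−n})` (a monotone bounded prefactor, `r ≤ · ≤ 2r`, giving a
  per-step multiplicative slack `(1 + 2^{−(n+2)})·klIdxPrefactor r n ≤ klIdxPrefactor r (n+1)` — the home of the cross-frame RELATIVE defects of the (F)(i) value door);
  `klIdxMass_succ` (`n+1 ≤ m′ ⇒ klIdxMass (n+1) m′ = 4·klIdxMass n m′`), `klIdxOverlap_eq_zero` (`n < m′`), the actual weights are below the index weights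
  (`klSoftMass_compl_sub_compl_le_klIdxMass`, `klShellOverlap_compl_sub_compl_le_klIdxOverlap`, every `FrameOK` frame, `klBetaMin ≤ β ≤ L`).
* §2 **`transferBarRelIdx L G P r β U n m′ := transferBarRelAtWF L G P (klIdxPrefactor r n) β U n (klIdxMass n m′) (klIdxOverlap n m′)`** — the proposed `TB` of the
  index-keyed class-#5 wrapper (`PairTransferRelFamilyK5 … n := ∀ m m′, n ≤ m′ → m′ ≤ m → m ≤ nScales β + 1 → PairTransferRelAt … n (transferBarRelIdx … n m′) s_{n,m} s_{n,m′}`,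
  p1b's Export5); `transferBarRelIdx_nonneg`, `transferBarRelIdx_self`, the symbol-keyed bar is BELOW it (`transferBarRelAtF_le_transferBarRelIdx`: a clause proved with
  `transferBarRelAtF` at the un-inflated `r` gives the index-keyed clause by `.mono`), and **`transferBarRelIdx_succ_room`**: for `n+1 ≤ m′`,
  `(1 + 2^{−(n+2)})·transferBarRelIdx(n, m′) + klIdxPrefactor r (n+1)·{room of `transferBarRelAtWF_succ_room` at `ms = klIdxMass n m′`, `ov′ = klIdxOverlap (n+1) m′`}
  ≤ transferBarRelIdx(n+1, m′)` — NO cross-frame comparison of masses anywhere.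
* §3 HOSTING for the consumer: `transferBarRelIdx_le_transferBarAt_addShellLog` (k3c1-p1's `transferBarRelAtWF_le_transferBarAt_addShellLog`, p587359, at `c = 15367`,
  `2r·15367 ≤ r′`, `2r·15367 ≤ r′·C`) and `pairTransferPinnedAt_compl_of_relIdx`: the index clause at the pinned pair `(m, m′ := n)` ⟹ rev 2's
  `PairTransferPinnedAt L M (G.addShellLog C) P r′ β U μ n (s_{n,m})` (step 3's history input at `m := n+1`, `pairLadderStepAtV17F2_of_pairTransferPinnedAt` p581707).
Real arithmetic over landed lemmas; nothing about the model is asserted; nothing asserts superconductivity.  0 kit · 0 lit.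
-/

noncomputable section

namespace Summit.HubbardSuperconductivity.HubbardSuperconductivity.Theorems.KLRegimeSplit

set_option linter.dupNamespace false -- summit = problem name (single-conjunct summit), D-0017

open Real Finset Literature.MathematicalPhysics.QuantumLattice Literature.Probability.LatticeModels
open Summit.HubbardSuperconductivity.HubbardSuperconductivity.Theorems.KLProgrammeLegKernels
open Summit.HubbardSuperconductivity.HubbardSuperconductivity.Theorems.DispersionFlow

/-! ## §1 The index weights and the prefactor -/

section Weights

/-- **The index mass** of the pair `(s_{n,m} | s_{n,m′})`: `15367·4^{−(m′−n)}` — the uniform, frame-free majorant of the soft mass of its difference `s_{m′,m}` at scale `n`. -/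
def klIdxMass (n m' : ℕ) : ℝ := 15367 * ((4 : ℝ) ^ (m' - n))⁻¹

/-- **The index overlap** of the pair `(s_{n,m} | s_{n,m′})`: `15367` on the PINNED pairs `m′ = n`, `0` otherwise (the born overlap of `s_{m′,m}` at scale `n` vanishes for
`m′ ≥ n+1`). -/
def klIdxOverlap (n m' : ℕ) : ℝ := if m' = n then 15367 else 0

/-- **The prefactor** `r·(2 − 2^{−n})`: monotone in `n`, between `r` and `2r`, with the per-step multiplicative slack `(1 + 2^{−(n+2)})·(2 − 2^{−n}) ≤ 2 − 2^{−(n+1)}`. -/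
def klIdxPrefactor (r : ℝ) (n : ℕ) : ℝ := r * (2 - ((2 : ℝ) ^ n)⁻¹)

/-- `0 ≤ klIdxMass`. -/
theorem klIdxMass_nonneg (n m' : ℕ) : 0 ≤ klIdxMass n m' := by unfold klIdxMass; positivity

/-- `klIdxMass ≤ 15367`. -/
theorem klIdxMass_le (n m' : ℕ) : klIdxMass n m' ≤ 15367 := by
  unfold klIdxMass
  have h : ((4 : ℝ) ^ (m' - n))⁻¹ ≤ 1 := inv_le_one_of_one_le₀ (one_le_pow₀ (by norm_num))
  nlinarith

/-- On the pinned pairs the index mass is `15367`. -/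
@[simp] theorem klIdxMass_self (n : ℕ) : klIdxMass n n = 15367 := by simp [klIdxMass]

/-- **ARITHMETIC INHERITANCE**: for a history pair (`n+1 ≤ m′`) the index mass QUADRUPLES at the next scale — `klIdxMass (n+1) m′ = 4·klIdxMass n m′`. -/
theorem klIdxMass_succ {n m' : ℕ} (h : n + 1 ≤ m') : klIdxMass (n + 1) m' = 4 * klIdxMass n m' := by
  unfold klIdxMass
  obtain ⟨d, rfl⟩ := Nat.exists_eq_add_of_le h
  have e1 : n + 1 + d - (n + 1) = d := by omega
  have e2 : n + 1 + d - n = d + 1 := by omega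
  rw [e1, e2, pow_succ]
  field_simp

/-- `0 ≤ klIdxOverlap`. -/
theorem klIdxOverlap_nonneg (n m' : ℕ) : 0 ≤ klIdxOverlap n m' := by unfold klIdxOverlap; split_ifs <;> norm_num

/-- `klIdxOverlap ≤ 15367`. -/
theorem klIdxOverlap_le (n m' : ℕ) : klIdxOverlap n m' ≤ 15367 := by unfold klIdxOverlap; split_ifs <;> norm_num

/-- On the pinned pairs the index overlap is `15367`. -/
@[simp] theorem klIdxOverlap_self (n : ℕ) : klIdxOverlap n n = 15367 := by simp [klIdxOverlap]

/-- Off the pinned pairs (`n < m′`) the index overlap is `0`. -/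
theorem klIdxOverlap_eq_zero {n m' : ℕ} (h : n < m') : klIdxOverlap n m' = 0 := by
  unfold klIdxOverlap; rw [if_neg (by omega)]

/-- `r ≤ klIdxPrefactor r n` (`0 ≤ r`). -/
theorem le_klIdxPrefactor {r : ℝ} (hr : 0 ≤ r) (n : ℕ) : r ≤ klIdxPrefactor r n := by
  unfold klIdxPrefactor
  have h : ((2 : ℝ) ^ n)⁻¹ ≤ 1 := inv_le_one_of_one_le₀ (one_le_pow₀ (by norm_num))
  nlinarith

/-- `klIdxPrefactor r n ≤ 2r` (`0 ≤ r`). -/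
theorem klIdxPrefactor_le {r : ℝ} (hr : 0 ≤ r) (n : ℕ) : klIdxPrefactor r n ≤ 2 * r := by
  unfold klIdxPrefactor
  have h : 0 ≤ ((2 : ℝ) ^ n)⁻¹ := by positivity
  nlinarith

/-- `0 ≤ klIdxPrefactor r n` (`0 ≤ r`). -/
theorem klIdxPrefactor_nonneg {r : ℝ} (hr : 0 ≤ r) (n : ℕ) : 0 ≤ klIdxPrefactor r n := hr.trans (le_klIdxPrefactor hr n)

/-- **THE PER-STEP SLACK**: `(1 + 2^{−(n+2)})·klIdxPrefactor r n ≤ klIdxPrefactor r (n+1)` (`0 ≤ r`). -/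
theorem klIdxPrefactor_succ_slack {r : ℝ} (hr : 0 ≤ r) (n : ℕ) :
    (1 + ((2 : ℝ) ^ (n + 2))⁻¹) * klIdxPrefactor r n ≤ klIdxPrefactor r (n + 1) := by
  unfold klIdxPrefactor
  have h2 : (0 : ℝ) < (2 : ℝ) ^ n := by positivity
  rw [pow_succ, pow_add, mul_inv, mul_inv]
  have hx : 0 ≤ ((2 : ℝ) ^ n)⁻¹ := by positivity
  have hx1 : ((2 : ℝ) ^ n)⁻¹ ≤ 1 := inv_le_one_of_one_le₀ (one_le_pow₀ (by norm_num))
  nlinarith [mul_nonneg hr hx, mul_nonneg (mul_nonneg hr hx) hx]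

/-- Monotonicity of the prefactor: `klIdxPrefactor r n ≤ klIdxPrefactor r (n+1)` (`0 ≤ r`). -/
theorem klIdxPrefactor_le_succ {r : ℝ} (hr : 0 ≤ r) (n : ℕ) : klIdxPrefactor r n ≤ klIdxPrefactor r (n + 1) := by
  have h := klIdxPrefactor_succ_slack hr n
  have h0 := klIdxPrefactor_nonneg hr n
  have h1 : 0 ≤ ((2 : ℝ) ^ (n + 2))⁻¹ := by positivity
  nlinarith

variable {L M : ℕ} [NeZero L] (β μ : ℝ) (K : TrigPolyC4v) {R : RenConsts} {U : ℝ} {N : ℕ}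

/-- **The actual soft mass is below the index mass** in every admissible frame: `klSoftMass K n (s_{n,m} − s_{n,m′}) ≤ klIdxMass n m′` (`FrameOK` frame, `klBetaMin ≤ β ≤ L`,
`n ≤ m′ ≤ m`). -/
theorem klSoftMass_compl_sub_compl_le_klIdxMass (hK : FrameOK R U N μ K) (hβ : klBetaMin ≤ β) (hβL : β ≤ L) {n m m' : ℕ} (hn : n ≤ m') (h : m' ≤ m) :
    klSoftMass L M β μ K n (softSymbolCompl L M β μ K n m - softSymbolCompl L M β μ K n m') ≤ klIdxMass n m' :=
  klSoftMass_compl_sub_compl_le_deep β μ K hK hβ hβL hn h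

/-- **The actual born overlap is below the index overlap** in every admissible frame (`n ≤ m′ ≤ m`): `0` off the pinned pairs, `≤ 15367` on them. -/
theorem klShellOverlap_compl_sub_compl_le_klIdxOverlap (hK : FrameOK R U N μ K) (hβ : klBetaMin ≤ β) (hβL : β ≤ L) {n m m' : ℕ} (hn : n ≤ m') (h : m' ≤ m) :
    klShellOverlap L M β μ K n (softSymbolCompl L M β μ K n m - softSymbolCompl L M β μ K n m') ≤ klIdxOverlap n m' := by
  rcases hn.eq_or_lt with heq | hlt
  · subst heq
    rw [klIdxOverlap_self]
    exact klShellOverlap_compl_sub_compl_le β μ K hK hβ hβL le_rfl h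
  · rw [klIdxOverlap_eq_zero hlt, klShellOverlap_compl_sub_compl_eq_zero β μ K (Nat.succ_le_of_lt hlt) h]

end Weights

/-! ## §2 The index-keyed bar and its arithmetic inheritance -/

section Bar

variable (L : ℕ)

/-- **`transferBarRelIdx L G P r β U n m′`** — the relative bar of the pair `(s_{n,m} | s_{n,m′})` keyed on its INDICES: `transferBarRelAtWF` at the prefactor `r·(2 − 2^{−n})`,
the index mass `15367·4^{−(m′−n)}` and the index overlap `15367·[m′ = n]`. -/
def transferBarRelIdx (G : GeoConsts) (P : SplitConsts) (r β U : ℝ) (n m' : ℕ) (Qm k k' : TorusSite 2 L) : ℝ :=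
  transferBarRelAtWF L G P (klIdxPrefactor r n) β U n (klIdxMass n m') (klIdxOverlap n m') Qm k k'

variable {L}

/-- Unfolding. -/
theorem transferBarRelIdx_eq (G : GeoConsts) (P : SplitConsts) (r β U : ℝ) (n m' : ℕ) (Qm k k' : TorusSite 2 L) :
    transferBarRelIdx L G P r β U n m' Qm k k' = transferBarRelAtWF L G P (klIdxPrefactor r n) β U n (klIdxMass n m') (klIdxOverlap n m') Qm k k' := rfl

/-- Nonnegativity (`0 ≤ r`, `0 ≤ P.Klam`, `0 ≤ G.CF`). -/
theorem transferBarRelIdx_nonneg {G : GeoConsts} (hCF : 0 ≤ G.CF) {P : SplitConsts} (hK : 0 ≤ P.Klam) {r : ℝ} (hr : 0 ≤ r) (β U : ℝ) (n m' : ℕ)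
    (Qm k k' : TorusSite 2 L) : 0 ≤ transferBarRelIdx L G P r β U n m' Qm k k' :=
  transferBarRelAtWF_nonneg hCF hK (klIdxPrefactor_nonneg hr n) β U n (klIdxMass_nonneg n m') (klIdxOverlap_nonneg n m') Qm k k'

/-- The PINNED pair's bar: `transferBarRelIdx … n n = transferBarRelAtWF … (r(2 − 2^{−n})) … n 15367 15367`. -/
theorem transferBarRelIdx_self (G : GeoConsts) (P : SplitConsts) (r β U : ℝ) (n : ℕ) (Qm k k' : TorusSite 2 L) :
    transferBarRelIdx L G P r β U n n Qm k k' = transferBarRelAtWF L G P (klIdxPrefactor r n) β U n 15367 15367 Qm k k' := by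
  rw [transferBarRelIdx_eq, klIdxMass_self, klIdxOverlap_self]

/-- `transferBarRelAtWF` is LINEAR in `r`. -/
theorem transferBarRelAtWF_mul_r (G : GeoConsts) (P : SplitConsts) (c r β U : ℝ) (n : ℕ) (ms ov : ℝ) (Qm k k' : TorusSite 2 L) :
    transferBarRelAtWF L G P (c * r) β U n ms ov Qm k k' = c * transferBarRelAtWF L G P r β U n ms ov Qm k k' := by
  rw [transferBarRelAtWF_eq, transferBarRelAtWF_eq]
  ring

/-- Monotonicity of `transferBarRelAtWF` in `r` (nonnegative weights). -/
theorem transferBarRelAtWF_mono_r {G : GeoConsts} (hCF : 0 ≤ G.CF) {P : SplitConsts} (hK : 0 ≤ P.Klam) {r r' : ℝ} (hrr : r ≤ r') (β U : ℝ) (n : ℕ) {ms ov : ℝ}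
    (hms : 0 ≤ ms) (hov : 0 ≤ ov) (Qm k k' : TorusSite 2 L) :
    transferBarRelAtWF L G P r β U n ms ov Qm k k' ≤ transferBarRelAtWF L G P r' β U n ms ov Qm k k' := by
  unfold transferBarRelAtWF
  exact transferBarRelAtW_mono_r hCF hK hrr β U n hms (by positivity) Qm k k'

section Compare

variable {M : ℕ} [NeZero L] [NeZero M] {R : RenConsts} {N : ℕ}

/-- **The symbol-keyed bar of record is BELOW the index-keyed bar** (every admissible flowing frame, `klBetaMin ≤ β ≤ L`, `n ≤ m′ ≤ m`, `0 ≤ r`): a clause proved with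
`transferBarRelAtF … n s_{n,m} s_{n,m′}` at the un-inflated `r` gives the index-keyed clause by `PairTransferRelAt.mono`. -/
theorem transferBarRelAtF_le_transferBarRelIdx {G : GeoConsts} (hCF : 0 ≤ G.CF) {P : SplitConsts} (hK : 0 ≤ P.Klam) {r : ℝ} (hr : 0 ≤ r) {β U μ : ℝ} {n m m' : ℕ}
    (hKn : FrameOK R U N μ (klFlowFrameU L M β U μ n)) (hβ : klBetaMin ≤ β) (hβL : β ≤ L) (hn : n ≤ m') (h : m' ≤ m) (Qm k k' : TorusSite 2 L) :
    transferBarRelAtF L M G P r β U μ n (softSymbolCompl L M β μ (klFlowFrameU L M β U μ n) n m) (softSymbolCompl L M β μ (klFlowFrameU L M β U μ n) n m') Qm k k' ≤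
      transferBarRelIdx L G P r β U n m' Qm k k' := by
  unfold transferBarRelAtF transferBarRelIdx
  have hβ0 : 0 < β := pos_of_klBetaMin_le hβ
  refine (transferBarRelAtWF_mono hCF hK hr β U n (klSoftMass_compl_sub_compl_le_klIdxMass β μ _ hKn hβ hβL hn h)
    (klShellOverlap_compl_sub_compl_le_klIdxOverlap β μ _ hKn hβ hβL hn h) Qm k k').trans ?_
  exact transferBarRelAtWF_mono_r hCF hK (le_klIdxPrefactor hr n) β U n (klIdxMass_nonneg n m') (klIdxOverlap_nonneg n m') Qm k k'

end Compare

/-- **INHERITANCE ROOM, index-keyed — pure arithmetic.**  For a history pair (`n+1 ≤ m′`), with `ms := klIdxMass n m′`, `ov′ := klIdxOverlap (n+1) m′`, `r₁ := klIdxPrefactor r (n+1)`: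
`(1 + 2^{−(n+2)})·transferBarRelIdx(n, m′) + r₁·{(KlamU)²[(u(ρ_d) + u(ρ_x) + 2^{−n} + 3/L)·ms + (4ⁿ⁺¹)⁻¹·ov′] + [(Klam|U|)³2^{−n} + 3·thermalBar(n+1)]·ms} ≤ transferBarRelIdx(n+1, m′)` —
the inherited bar inflated by the frame slack `1 + 2^{−(n+2)}` (the home of the (F)(i) RELATIVE re-framing defect) plus the booked room for the slice's relative sources
fits under the new bar, with NO cross-frame comparison of masses (`klIdxMass_succ`). -/
theorem transferBarRelIdx_succ_room {G : GeoConsts} (hCF : 0 ≤ G.CF) (P : SplitConsts) (hK : 0 ≤ P.Klam) {r : ℝ} (hr : 0 ≤ r) (β U : ℝ) {n m' : ℕ} (hn : n + 1 ≤ m')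
    (Qm k k' : TorusSite 2 L) :
    (1 + ((2 : ℝ) ^ (n + 2))⁻¹) * transferBarRelIdx L G P r β U n m' Qm k k' +
        klIdxPrefactor r (n + 1) * ((P.Klam * U) ^ 2 *
              ((min (klTorusNorm L (k - k') / klScale klE0 (n + 1)) (klScale klE0 (n + 1) / klTorusNorm L (k - k')) +
                  min (klTorusNorm L (k + k' - Qm) / klScale klE0 (n + 1)) (klScale klE0 (n + 1) / klTorusNorm L (k + k' - Qm)) +
                  ((2 : ℝ) ^ n)⁻¹ + 3 * ((L : ℝ))⁻¹) * klIdxMass n m' + ((4 : ℝ) ^ (n + 1))⁻¹ * klIdxOverlap (n + 1) m') +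
            ((P.Klam * |U|) ^ 3 * ((2 : ℝ) ^ n)⁻¹ + 3 * thermalBar G P U β (n + 1)) * klIdxMass n m') ≤
      transferBarRelIdx L G P r β U (n + 1) m' Qm k k' := by
  have hms := klIdxMass_nonneg n m'
  have hr1 := klIdxPrefactor_nonneg hr (n + 1)
  -- the inherited bar carries overlap `0` (history pairs are never pinned)
  have hov0 : klIdxOverlap n m' = 0 := klIdxOverlap_eq_zero (by omega)
  -- (1) inflate the prefactor: `(1 + 2^{−(n+2)})·W_F(r_n; n, ms, 0) ≤ W_F(r_{n+1}; n, ms, 0)`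
  have h1 : (1 + ((2 : ℝ) ^ (n + 2))⁻¹) * transferBarRelIdx L G P r β U n m' Qm k k' ≤
      transferBarRelAtWF L G P (klIdxPrefactor r (n + 1)) β U n (klIdxMass n m') 0 Qm k k' := by
    rw [transferBarRelIdx_eq, hov0, ← transferBarRelAtWF_mul_r]
    exact transferBarRelAtWF_mono_r hCF hK (klIdxPrefactor_succ_slack hr n) β U n hms le_rfl Qm k k'
  -- (2) the room lemma at `r_{n+1}`
  have h2 := transferBarRelAtWF_succ_room (L := L) hCF P hr1 β U n hms (klIdxOverlap (n + 1) m') Qm k k'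
  -- (3) the new bar: `4·ms = klIdxMass (n+1) m′`
  have h3 : transferBarRelIdx L G P r β U (n + 1) m' Qm k k' =
      transferBarRelAtWF L G P (klIdxPrefactor r (n + 1)) β U (n + 1) (4 * klIdxMass n m') (klIdxOverlap (n + 1) m') Qm k k' := by
    rw [transferBarRelIdx_eq, klIdxMass_succ hn]
  rw [h3]
  linarith

end Bar

/-! ## §3 Hosting for the consumer -/

section Hosting

variable {L M : ℕ}

/-- **HOSTING**: `transferBarRelIdx L G P r β U n m′ ≤ transferBarAt L (G.addShellLog C) P r′ β U n` at every label, for `0 ≤ r`, `2r·15367 ≤ r′`, `2r·15367 ≤ r′·C`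
(`0 ≤ C`, `0 ≤ P.Klam`, `0 ≤ G.CF`, `0 ≤ G.phGain`) — k3c1-p1's `transferBarRelAtWF_le_transferBarAt_addShellLog` (p587359) at `c = 15367` after `klIdxPrefactor r n ≤ 2r`. -/
theorem transferBarRelIdx_le_transferBarAt_addShellLog {G : GeoConsts} (hCF : 0 ≤ G.CF) (hph : ∀ n ρ, 0 ≤ G.phGain n ρ) {P : SplitConsts} (hK : 0 ≤ P.Klam)
    {C r r' : ℝ} (hC : 0 ≤ C) (hr : 0 ≤ r) (hrc : 2 * r * 15367 ≤ r') (hrcC : 2 * r * 15367 ≤ r' * C) (β U : ℝ) (n m' : ℕ) (Qm k k' : TorusSite 2 L) :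
    transferBarRelIdx L G P r β U n m' Qm k k' ≤ transferBarAt L (G.addShellLog C) P r' β U n Qm k k' := by
  rw [transferBarRelIdx_eq]
  refine (transferBarRelAtWF_mono_r hCF hK (klIdxPrefactor_le hr n) β U n (klIdxMass_nonneg n m') (klIdxOverlap_nonneg n m') Qm k k').trans ?_
  exact transferBarRelAtWF_le_transferBarAt_addShellLog hCF hph hK hC (by positivity) hrc hrcC β U n (klIdxMass_nonneg n m') (klIdxMass_le n m')
    (klIdxOverlap_le n m') Qm k k'

variable [NeZero L] [NeZero M]

/-- **The consumer's history input from the index clause**: the relative clause at the PINNED pair `(s_{n,m} | s_{n,n})` (`s_{n,n} = 0`) with the index-keyed bar gives rev 2's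
`PairTransferPinnedAt L M (G.addShellLog C) P r′ β U μ n (s_{n,m})` (step 3 reads `m := n+1`: `pairLadderStepAtV17F2_of_pairTransferPinnedAt`, p581707). -/
theorem pairTransferPinnedAt_compl_of_relIdx {G : GeoConsts} (hCF : 0 ≤ G.CF) (hph : ∀ n ρ, 0 ≤ G.phGain n ρ) {P : SplitConsts} (hK : 0 ≤ P.Klam)
    {C r r' β U μ : ℝ} (hC : 0 ≤ C) (hr : 0 ≤ r) (hrc : 2 * r * 15367 ≤ r') (hrcC : 2 * r * 15367 ≤ r' * C) {n m : ℕ}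
    (h : PairTransferRelAt L M β U μ n (transferBarRelIdx L G P r β U n n)
      (softSymbolCompl L M β μ (klFlowFrameU L M β U μ n) n m) (softSymbolCompl L M β μ (klFlowFrameU L M β U μ n) n n)) :
    PairTransferPinnedAt L M (G.addShellLog C) P r' β U μ n (softSymbolCompl L M β μ (klFlowFrameU L M β U μ n) n m) := by
  rw [softSymbolCompl_self] at h
  exact pairTransferPinnedAt_of_rel h fun Qm k k' => transferBarRelIdx_le_transferBarAt_addShellLog hCF hph hK hC hr hrc hrcC β U n n Qm k k'

/-- The same without the amendment: the index clause at the pinned pair with ANY hosting `transferBarRelIdx … n n ≤ transferBarAt L G′ P r′ β U n` gives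
`PairTransferPinnedAt L M G′ P r′ β U μ n (s_{n,m})`. -/
theorem pairTransferPinnedAt_compl_of_relIdx_of_le {G G' : GeoConsts} {P : SplitConsts} {r r' β U μ : ℝ} {n m : ℕ}
    (h : PairTransferRelAt L M β U μ n (transferBarRelIdx L G P r β U n n)
      (softSymbolCompl L M β μ (klFlowFrameU L M β U μ n) n m) (softSymbolCompl L M β μ (klFlowFrameU L M β U μ n) n n))
    (hle : ∀ Qm k k', transferBarRelIdx L G P r β U n n Qm k k' ≤ transferBarAt L G' P r' β U n Qm k k') :
    PairTransferPinnedAt L M G' P r' β U μ n (softSymbolCompl L M β μ (klFlowFrameU L M β U μ n) n m) := by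
  rw [softSymbolCompl_self] at h
  exact pairTransferPinnedAt_of_rel h hle

end Hosting

end Summit.HubbardSuperconductivity.HubbardSuperconductivity.Theorems.KLRegimeSplit

end
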